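import Summits.QuantumFields.YangMills.Theorems.BalabanUVNodesN11NoSLawOneAtAnyLiveWitness
import Literature.MathematicalPhysics.QuantumFieldTheory.Balaban1983to89.B16RLeafRecord13SepCo

/-!
# DAG node N11 — THE NODE READING OF `…N11NoSLawOneAtAnyLiveWitness` AT THE Co ∕ v1.4 RECORDS: Theorem 1's conclusion `densitiesDescribed` is FALSE, and a
# TRUE N11 conjunct `Dag.B14_main` forces `¬ smallCouplings`, at every world bound to `datumOfRecord₁₃Co θ h` ∕ `datumOfRecord₁₃SepCo θ h` of a LIVE witness
# (in particular the witness of record `theta13LiveOfRecord`), on every run with `K ≥ 1` meeting dag-n11-d's guards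

Cell `pub-ymgap`, YM-PLAN Track A (HUMAN RULING D-0062), seat `pub-ymgap-dag-n11-e` (g7; R134 fan-out seat N11 [B14], strategy s3), item K1⁗ `StabilityBAtRecordR13Sep`
= stmt-QuantumFields-20290 (helper; director-ym LINE №160 (8)).  [III] = [Balaban1988Convergent], [I] = [Balaban1989LargeFieldI], [B7] = [Balaban1985Averaging].

WHAT THIS FILE PROVES (0 `sorry`, 0 `def`, standard axioms).  The node conclusion at a world bound to the Co construction of record IS `∀ k ≤ K, SLaw₁₃Co θ p k`
(`…B16RLeafRecord13LiveCo.densitiesDescribed_leavesP_iff_sLaw₁₃Co_all[_datum]`, `…SepCo.…_sepCo`), and `SLaw₁₃Co θ p 1` is false on the live line under the guards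
(`…NoSLawOneAtAnyLiveWitness.not_sLaw₁₃Co_one_of_liveSel_of_hasResiduals`):
* §1 generic live `θ` with K0b's residuals, Core(Co)-keyed (`h : Provisos₁₃Core`, director-ym №152 §4 «key ONCE on Core(Co)»; v1.4 holders pass `h.toCore`, same datum by
  `rfl`): **`not_densitiesDescribed_leavesP_record₁₃Co_of_liveSel`**; with the C-binding `w.up p = upOfRecord₅C … (θ.toStage5₁₃Co)` (under which `rOperation` reads TRUE on
  the live line, `…LiveCo.rOperation_leavesP_of_liveSel₁₃Co_of_hasResiduals`) **`not_smallCouplings_of_b14_main_leavesP_record₁₃Co_of_liveSel`** — a true N11 conjunct whose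
  in-edges `b7–b11`, `sC → sFI`, `sC → flowControl` read true forces `¬ (leavesP w p).smallCouplings`; the v1.4-keyed forms `…_sepCo` (`h : Provisos₁₃SepCo`).
* §2 at the witness of record `theta13LiveOfRecord` (every witness letter discharged; the run's guards remain): **`not_densitiesDescribed_leavesP_theta13LiveOfRecord_sepCo`**,
  **`not_smallCouplings_of_b14_main_leavesP_theta13LiveOfRecord_sepCo`**, and at the group of record `SU(2)` (both thresholds `< 2`) **`…_su2`** ×2.

READING (count-neutral; nothing of Bałaban asserted or refuted).  K1⁵'s rung 1 asks `∀ P, Nodes (leavesP w P)` at a world bound to the v1.4 datum of the chosen `θ`;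
at any LIVE `θ` (K0a's witnesses are live) its N11 conjunct is dischargeable at a run `P` with `1 ≤ P.K` meeting [B7]'s guards ONLY VACUOUSLY (a false in-edge or
`¬ smallCouplings`) — because the typed §2 slot carries the regularity factor on all of `Ω₁(s′)ᶜ` (director-ym №160 FINDING №7; cure F7 = v1.5 `CoP`).  K1⁗∕K1⁵ (an
`∃ θ` statement) is NOT refuted; N11 NOT discharged; typed 28∕28 · discharged 5∕28 UNMOVED.  One finite four-torus at fixed `ε = L^{−K}`; NOT ℝ⁴ ∕ OS ∕ mass gap ∕ Clay.
-/

noncomputable section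

open MeasureTheory
open scoped BigOperators Matrix.Norms.L2Operator

namespace Summit.QuantumFields.YangMills.Theorems.BalabanUVNodesN11NoDensitiesDescribedAtLiveRecordCo

open Literature.MathematicalPhysics.QuantumFieldTheory.Balaban1983to89 T4Continuum T4DatumAssembly Node00 DagBinding
open Literature.MathematicalPhysics.QuantumFieldTheory.Balaban1983to89.ExpMeanLog (deltaSU)
open Summit.QuantumFields.YangMills.Theorems.BalabanUVNodesN11NoSLawOneAtAnyLiveWitness
open B16RLeafRecord13LiveCo (densitiesDescribed_leavesP_iff_sLaw₁₃Co_all_datum rOperation_leavesP_of_liveSel₁₃Co_of_hasResiduals rOperation_leavesP_theta13LiveOfRecord_Co)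
open B16RLeafRecord13SepCo (densitiesDescribed_leavesP_iff_sLaw₁₃Co_all_sepCo)
open B16RLeafRecord13AtLive (liveRepin₁₃_liveSel)

variable {F : T4Family} {N : ℕ} [NeZero N]

/-! ## §1. Generic live `θ`: the node conclusion is false; a true N11 conjunct forces `¬ smallCouplings` -/

section Generic

variable (θ : Stage13Params F N) (p : B12.RunParams) (w : WorldP)

/-- ★★★ **THEOREM 1's CONCLUSION `densitiesDescribed` IS FALSE AT EVERY WORLD BOUND TO THE Co DATUM OF A LIVE WITNESS**, `K ≥ 1`, under dag-n11-d's guards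
(K0b's residuals; Core(Co) key `h : Provisos₁₃Core`). [cite: Balaban1988Convergent, Thm 1 p.262, Theorem p.245, (2.18) p.257, (3.16) p.268, (3.25) p.270; Balaban1989LargeFieldI, (0.3)–(0.4) p.176; Balaban1985Averaging, Prop. 1 (51) pp.25–26, Prop. 2 (52)–(54) p.26] -/
theorem not_densitiesDescribed_leavesP_record₁₃Co_of_liveSel (h : θ.Provisos₁₃Core F N) (hC : w.C = (datumOfRecord₁₃Co F N θ h).C)
    (hres : θ.HasResidualsOfRecord F N) (hsel : θ.ppSel = ppSelLiveOfRecord F N θ.ν θ.τ9 (EOfRecord₁₃ F N θ) (wOfRecord₉ F N θ.toStage9Params))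
    (hK : 0 < p.K) (hMτ : 1 ≤ θ.τ9.M) (hM₂ : 1 ≤ θ.ν.M₂)
    (hS : 2 * ((((F.P p.K).d + 4) * (F.P p.K).L + 2) + (F.P p.K).L + 1) ≤ sideχ F θ.ν p (gOfRecord₁₃ F N θ p) 0)
    (ha : 0 < θ.s2.cR * epsOfRecord θ.ν (gOfRecord₁₃ F N θ p) 0)
    (has : ((((F.P p.K).d + 4) * (F.P p.K).L : ℕ) : ℝ) ^ 2 / 4 * (θ.s2.cR * epsOfRecord θ.ν (gOfRecord₁₃ F N θ p) 0) ≤ deltaSU (Fin N) / 2)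
    {β : ℝ} (hβ : 0 < β) (hβ3 : (143 * (((((F.P p.K).d + 4 : ℕ) : ℝ)) ^ 2 / 4) ^ 2) * β ≤ 1 / 3)
    (hβ2 : 2 * β ≤ 2 * deltaSU (Fin N) / ((((F.P p.K).d + 4) * (F.P p.K).L : ℕ) : ℝ) ^ 2)
    (hβε : epsOfRecord θ.ν (gOfRecord₁₃ F N θ p) 1 * (F.P p.K).eta 1 ^ 2 + 4 * (2 * deltaOfRecord θ.ν (gOfRecord₁₃ F N θ p) 0 θ.A₁) ≤
      β * (F.P p.K).eta 1 ^ 2)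
    (hg : ∃ g₀ : SU N,
      ((F.P p.K).L : ℝ) ^ 2 * (θ.s2.cR * epsOfRecord θ.ν (gOfRecord₁₃ F N θ p) 0) +
          143 * (((((F.P p.K).d + 4) * (F.P p.K).L : ℕ) : ℝ) ^ 2 / 4 * (θ.s2.cR * epsOfRecord θ.ν (gOfRecord₁₃ F N θ p) 0)) ^ 2 < dist1 g₀ ∧
        2 * β < dist1 g₀) :
    ¬ (leavesP w p).densitiesDescribed := fun hD =>
  not_sLaw₁₃Co_one_of_liveSel_of_hasResiduals θ p hres hsel hK hMτ hM₂ hS ha has hβ hβ3 hβ2 hβε hg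
    ((densitiesDescribed_leavesP_iff_sLaw₁₃Co_all_datum F N θ p w h hC).1 hD 1 hK)

/-- ★★★ **A TRUE N11 CONJUNCT `Dag.B14_main (leavesP w p)` AT SUCH A WORLD, with the C-binding of record over the Co view (so the `rOperation` antecedent reads TRUE on
the live line) and in-edges `b7–b11`, `sC → sFI`, `sC → flowControl` reading true, FORCES `¬ (leavesP w p).smallCouplings`** (admissibility and the three signs feed the
𝐑-leaf). [cite: Balaban1988Convergent, Thm 1 p.262, Theorem p.245, p.244, (3.25) p.270; Balaban1989LargeFieldI, (0.3)–(0.4) p.176; Balaban1989LargeFieldII, Thm 1 p.355 (bookkeeping); Balaban1985Averaging, Prop. 1 (51) pp.25–26, Prop. 2 (52)–(54) p.26] -/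
theorem not_smallCouplings_of_b14_main_leavesP_record₁₃Co_of_liveSel (h : θ.Provisos₁₃Core F N) (hC : w.C = (datumOfRecord₁₃Co F N θ h).C)
    (hup : w.up p = upOfRecord₅C F N (θ.toStage5₁₃Co F N) p)
    (hres : θ.HasResidualsOfRecord F N) (hθ : θ.Admissible F N) (hκ : 0 ≤ θ.s2.lf.κ) (hE₀ : 0 ≤ θ.s2.lf.E₀) (hB₀ : 0 ≤ θ.s2.lf.B₀)
    (hsel : θ.ppSel = ppSelLiveOfRecord F N θ.ν θ.τ9 (EOfRecord₁₃ F N θ) (wOfRecord₉ F N θ.toStage9Params))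
    (h14 : Dag.B14_main (leavesP w p)) (h7 : (leavesP w p).b7) (h8 : (leavesP w p).b8) (h9 : (leavesP w p).b9) (h10 : (leavesP w p).b10)
    (h11 : (leavesP w p).b11) (hsf : (leavesP w p).smallCouplings → (leavesP w p).smallFieldInductive)
    (hfc : (leavesP w p).smallCouplings → (leavesP w p).flowControl)
    (hK : 0 < p.K) (hMτ : 1 ≤ θ.τ9.M) (hM₂ : 1 ≤ θ.ν.M₂)
    (hS : 2 * ((((F.P p.K).d + 4) * (F.P p.K).L + 2) + (F.P p.K).L + 1) ≤ sideχ F θ.ν p (gOfRecord₁₃ F N θ p) 0)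
    (ha : 0 < θ.s2.cR * epsOfRecord θ.ν (gOfRecord₁₃ F N θ p) 0)
    (has : ((((F.P p.K).d + 4) * (F.P p.K).L : ℕ) : ℝ) ^ 2 / 4 * (θ.s2.cR * epsOfRecord θ.ν (gOfRecord₁₃ F N θ p) 0) ≤ deltaSU (Fin N) / 2)
    {β : ℝ} (hβ : 0 < β) (hβ3 : (143 * (((((F.P p.K).d + 4 : ℕ) : ℝ)) ^ 2 / 4) ^ 2) * β ≤ 1 / 3)
    (hβ2 : 2 * β ≤ 2 * deltaSU (Fin N) / ((((F.P p.K).d + 4) * (F.P p.K).L : ℕ) : ℝ) ^ 2)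
    (hβε : epsOfRecord θ.ν (gOfRecord₁₃ F N θ p) 1 * (F.P p.K).eta 1 ^ 2 + 4 * (2 * deltaOfRecord θ.ν (gOfRecord₁₃ F N θ p) 0 θ.A₁) ≤
      β * (F.P p.K).eta 1 ^ 2)
    (hg : ∃ g₀ : SU N,
      ((F.P p.K).L : ℝ) ^ 2 * (θ.s2.cR * epsOfRecord θ.ν (gOfRecord₁₃ F N θ p) 0) +
          143 * (((((F.P p.K).d + 4) * (F.P p.K).L : ℕ) : ℝ) ^ 2 / 4 * (θ.s2.cR * epsOfRecord θ.ν (gOfRecord₁₃ F N θ p) 0)) ^ 2 < dist1 g₀ ∧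
        2 * β < dist1 g₀) :
    ¬ (leavesP w p).smallCouplings := fun hsc =>
  not_densitiesDescribed_leavesP_record₁₃Co_of_liveSel θ p w h hC hres hsel hK hMτ hM₂ hS ha has hβ hβ3 hβ2 hβε hg
    (h14 h7 h8 h9 h10 h11 hsf hfc (rOperation_leavesP_of_liveSel₁₃Co_of_hasResiduals F N θ p w hup hres hθ hκ hE₀ hB₀ hsel) hsc)

/-- **v1.4-KEYED: `¬ densitiesDescribed` at a world bound to `datumOfRecord₁₃SepCo θ h`** of a live witness (`h : Provisos₁₃SepCo`; the datum IS the Co datum at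
`h.toCore` by `rfl`, node00-def-T KEY-22T). [cite: Balaban1988Convergent, Thm 1 p.262, Theorem p.245, (3.25) p.270; Balaban1989LargeFieldI, (0.3)–(0.4) p.176; Balaban1985Averaging, Prop. 1 (51) pp.25–26, Prop. 2 (52)–(54) p.26] -/
theorem not_densitiesDescribed_leavesP_record₁₃SepCo_of_liveSel (h : θ.Provisos₁₃SepCo F N) (hC : w.C = (datumOfRecord₁₃SepCo F N θ h).C)
    (hres : θ.HasResidualsOfRecord F N) (hsel : θ.ppSel = ppSelLiveOfRecord F N θ.ν θ.τ9 (EOfRecord₁₃ F N θ) (wOfRecord₉ F N θ.toStage9Params))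
    (hK : 0 < p.K) (hMτ : 1 ≤ θ.τ9.M) (hM₂ : 1 ≤ θ.ν.M₂)
    (hS : 2 * ((((F.P p.K).d + 4) * (F.P p.K).L + 2) + (F.P p.K).L + 1) ≤ sideχ F θ.ν p (gOfRecord₁₃ F N θ p) 0)
    (ha : 0 < θ.s2.cR * epsOfRecord θ.ν (gOfRecord₁₃ F N θ p) 0)
    (has : ((((F.P p.K).d + 4) * (F.P p.K).L : ℕ) : ℝ) ^ 2 / 4 * (θ.s2.cR * epsOfRecord θ.ν (gOfRecord₁₃ F N θ p) 0) ≤ deltaSU (Fin N) / 2)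
    {β : ℝ} (hβ : 0 < β) (hβ3 : (143 * (((((F.P p.K).d + 4 : ℕ) : ℝ)) ^ 2 / 4) ^ 2) * β ≤ 1 / 3)
    (hβ2 : 2 * β ≤ 2 * deltaSU (Fin N) / ((((F.P p.K).d + 4) * (F.P p.K).L : ℕ) : ℝ) ^ 2)
    (hβε : epsOfRecord θ.ν (gOfRecord₁₃ F N θ p) 1 * (F.P p.K).eta 1 ^ 2 + 4 * (2 * deltaOfRecord θ.ν (gOfRecord₁₃ F N θ p) 0 θ.A₁) ≤
      β * (F.P p.K).eta 1 ^ 2)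
    (hg : ∃ g₀ : SU N,
      ((F.P p.K).L : ℝ) ^ 2 * (θ.s2.cR * epsOfRecord θ.ν (gOfRecord₁₃ F N θ p) 0) +
          143 * (((((F.P p.K).d + 4) * (F.P p.K).L : ℕ) : ℝ) ^ 2 / 4 * (θ.s2.cR * epsOfRecord θ.ν (gOfRecord₁₃ F N θ p) 0)) ^ 2 < dist1 g₀ ∧
        2 * β < dist1 g₀) :
    ¬ (leavesP w p).densitiesDescribed := fun hD =>
  not_sLaw₁₃Co_one_of_liveSel_of_hasResiduals θ p hres hsel hK hMτ hM₂ hS ha has hβ hβ3 hβ2 hβε hg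
    ((densitiesDescribed_leavesP_iff_sLaw₁₃Co_all_sepCo F N θ p w h hC).1 hD 1 hK)

/-- **v1.4-KEYED: a true N11 conjunct at a world bound to `datumOfRecord₁₃SepCo θ h` of a live witness (C-binding over the Co view; in-edges true) forces
`¬ smallCouplings`.** [cite: Balaban1988Convergent, Thm 1 p.262, Theorem p.245, p.244, (3.25) p.270; Balaban1989LargeFieldI, (0.3)–(0.4) p.176; Balaban1989LargeFieldII, Thm 1 p.355 (bookkeeping); Balaban1985Averaging, Prop. 1 (51) pp.25–26, Prop. 2 (52)–(54) p.26] -/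
theorem not_smallCouplings_of_b14_main_leavesP_record₁₃SepCo_of_liveSel (h : θ.Provisos₁₃SepCo F N) (hC : w.C = (datumOfRecord₁₃SepCo F N θ h).C)
    (hup : w.up p = upOfRecord₅C F N (θ.toStage5₁₃Co F N) p)
    (hres : θ.HasResidualsOfRecord F N) (hθ : θ.Admissible F N) (hκ : 0 ≤ θ.s2.lf.κ) (hE₀ : 0 ≤ θ.s2.lf.E₀) (hB₀ : 0 ≤ θ.s2.lf.B₀)
    (hsel : θ.ppSel = ppSelLiveOfRecord F N θ.ν θ.τ9 (EOfRecord₁₃ F N θ) (wOfRecord₉ F N θ.toStage9Params))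
    (h14 : Dag.B14_main (leavesP w p)) (h7 : (leavesP w p).b7) (h8 : (leavesP w p).b8) (h9 : (leavesP w p).b9) (h10 : (leavesP w p).b10)
    (h11 : (leavesP w p).b11) (hsf : (leavesP w p).smallCouplings → (leavesP w p).smallFieldInductive)
    (hfc : (leavesP w p).smallCouplings → (leavesP w p).flowControl)
    (hK : 0 < p.K) (hMτ : 1 ≤ θ.τ9.M) (hM₂ : 1 ≤ θ.ν.M₂)
    (hS : 2 * ((((F.P p.K).d + 4) * (F.P p.K).L + 2) + (F.P p.K).L + 1) ≤ sideχ F θ.ν p (gOfRecord₁₃ F N θ p) 0)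
    (ha : 0 < θ.s2.cR * epsOfRecord θ.ν (gOfRecord₁₃ F N θ p) 0)
    (has : ((((F.P p.K).d + 4) * (F.P p.K).L : ℕ) : ℝ) ^ 2 / 4 * (θ.s2.cR * epsOfRecord θ.ν (gOfRecord₁₃ F N θ p) 0) ≤ deltaSU (Fin N) / 2)
    {β : ℝ} (hβ : 0 < β) (hβ3 : (143 * (((((F.P p.K).d + 4 : ℕ) : ℝ)) ^ 2 / 4) ^ 2) * β ≤ 1 / 3)
    (hβ2 : 2 * β ≤ 2 * deltaSU (Fin N) / ((((F.P p.K).d + 4) * (F.P p.K).L : ℕ) : ℝ) ^ 2)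
    (hβε : epsOfRecord θ.ν (gOfRecord₁₃ F N θ p) 1 * (F.P p.K).eta 1 ^ 2 + 4 * (2 * deltaOfRecord θ.ν (gOfRecord₁₃ F N θ p) 0 θ.A₁) ≤
      β * (F.P p.K).eta 1 ^ 2)
    (hg : ∃ g₀ : SU N,
      ((F.P p.K).L : ℝ) ^ 2 * (θ.s2.cR * epsOfRecord θ.ν (gOfRecord₁₃ F N θ p) 0) +
          143 * (((((F.P p.K).d + 4) * (F.P p.K).L : ℕ) : ℝ) ^ 2 / 4 * (θ.s2.cR * epsOfRecord θ.ν (gOfRecord₁₃ F N θ p) 0)) ^ 2 < dist1 g₀ ∧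
        2 * β < dist1 g₀) :
    ¬ (leavesP w p).smallCouplings := fun hsc =>
  not_densitiesDescribed_leavesP_record₁₃SepCo_of_liveSel θ p w h hC hres hsel hK hMτ hM₂ hS ha has hβ hβ3 hβ2 hβε hg
    (h14 h7 h8 h9 h10 h11 hsf hfc (rOperation_leavesP_of_liveSel₁₃Co_of_hasResiduals F N θ p w hup hres hθ hκ hE₀ hB₀ hsel) hsc)

end Generic

/-! ## §2. At the witness of record `theta13LiveOfRecord`, v1.4 datum (K1⁵'s binder shape; every witness letter discharged) -/

section AtRecord

variable (F N)
variable (p : B12.RunParams) (w : WorldP) (h : (theta13LiveOfRecord F N).Provisos₁₃SepCo F N)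

/-- ★★★ **`¬ densitiesDescribed` AT EVERY WORLD BOUND TO THE v1.4 DATUM OF THE WITNESS OF RECORD**, on every run with `0 < K`, χ₁-cube side `2((d+5)L+3) ≤ sideχ`,
the [B7] Prop. 1 guard on `ε₀(g₀)`, the Prop. 2 guards on `β`, and `SU(N)` non-trivial at the two thresholds. [cite: Balaban1988Convergent, Thm 1 p.262, Theorem p.245, (3.16) p.268, (3.22) p.269, (3.25) p.270; Balaban1989LargeFieldI, (0.3)–(0.4) p.176; Balaban1985Averaging, Prop. 1 (51) pp.25–26, Prop. 2 (52)–(54) p.26] -/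
theorem not_densitiesDescribed_leavesP_theta13LiveOfRecord_sepCo (hC : w.C = (datumOfRecord₁₃SepCo F N (theta13LiveOfRecord F N) h).C) (hK : 0 < p.K)
    (hS : 2 * ((((F.P p.K).d + 4) * (F.P p.K).L + 2) + (F.P p.K).L + 1) ≤
      sideχ F (theta13LiveOfRecord F N).ν p (gOfRecord₁₃ F N (theta13LiveOfRecord F N) p) 0)
    (ha : 0 < epsOfRecord (theta13LiveOfRecord F N).ν (gOfRecord₁₃ F N (theta13LiveOfRecord F N) p) 0)
    (has : ((((F.P p.K).d + 4) * (F.P p.K).L : ℕ) : ℝ) ^ 2 / 4 * epsOfRecord (theta13LiveOfRecord F N).ν (gOfRecord₁₃ F N (theta13LiveOfRecord F N) p) 0 ≤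
      deltaSU (Fin N) / 2)
    {β : ℝ} (hβ : 0 < β) (hβ3 : (143 * (((((F.P p.K).d + 4 : ℕ) : ℝ)) ^ 2 / 4) ^ 2) * β ≤ 1 / 3)
    (hβ2 : 2 * β ≤ 2 * deltaSU (Fin N) / ((((F.P p.K).d + 4) * (F.P p.K).L : ℕ) : ℝ) ^ 2)
    (hβε : epsOfRecord (theta13LiveOfRecord F N).ν (gOfRecord₁₃ F N (theta13LiveOfRecord F N) p) 1 * (F.P p.K).eta 1 ^ 2 +
        4 * (2 * deltaOfRecord (theta13LiveOfRecord F N).ν (gOfRecord₁₃ F N (theta13LiveOfRecord F N) p) 0 (theta13LiveOfRecord F N).A₁) ≤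
      β * (F.P p.K).eta 1 ^ 2)
    (hg : ∃ g₀ : SU N,
      ((F.P p.K).L : ℝ) ^ 2 * epsOfRecord (theta13LiveOfRecord F N).ν (gOfRecord₁₃ F N (theta13LiveOfRecord F N) p) 0 +
          143 * (((((F.P p.K).d + 4) * (F.P p.K).L : ℕ) : ℝ) ^ 2 / 4 *
            epsOfRecord (theta13LiveOfRecord F N).ν (gOfRecord₁₃ F N (theta13LiveOfRecord F N) p) 0) ^ 2 < dist1 g₀ ∧
        2 * β < dist1 g₀) :
    ¬ (leavesP w p).densitiesDescribed := fun hD =>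
  not_sLaw₁₃Co_one_theta13LiveOfRecord F N p hK hS ha has hβ hβ3 hβ2 hβε hg
    ((densitiesDescribed_leavesP_iff_sLaw₁₃Co_all_sepCo F N (theta13LiveOfRecord F N) p w h hC).1 hD 1 hK)

/-- ★★★ **AT SUCH A WORLD WITH THE C-BINDING OF RECORD (`w.up p = upOfRecord₅C … (θ_live.toStage5₁₃Co)`, under which `rOperation` reads TRUE with NO hypothesis —
`…LiveCo.rOperation_leavesP_theta13LiveOfRecord_Co`), a TRUE N11 conjunct with true in-edges FORCES `¬ smallCouplings`.** [cite: Balaban1988Convergent, Thm 1 p.262, Theorem p.245, p.244, (3.25) p.270; Balaban1989LargeFieldI, (0.3)–(0.4) p.176; Balaban1989LargeFieldII, Thm 1 p.355 (bookkeeping); Balaban1985Averaging, Prop. 1 (51) pp.25–26, Prop. 2 (52)–(54) p.26] -/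
theorem not_smallCouplings_of_b14_main_leavesP_theta13LiveOfRecord_sepCo (hC : w.C = (datumOfRecord₁₃SepCo F N (theta13LiveOfRecord F N) h).C)
    (hup : w.up p = upOfRecord₅C F N ((theta13LiveOfRecord F N).toStage5₁₃Co F N) p)
    (h14 : Dag.B14_main (leavesP w p)) (h7 : (leavesP w p).b7) (h8 : (leavesP w p).b8) (h9 : (leavesP w p).b9) (h10 : (leavesP w p).b10)
    (h11 : (leavesP w p).b11) (hsf : (leavesP w p).smallCouplings → (leavesP w p).smallFieldInductive)
    (hfc : (leavesP w p).smallCouplings → (leavesP w p).flowControl) (hK : 0 < p.K)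
    (hS : 2 * ((((F.P p.K).d + 4) * (F.P p.K).L + 2) + (F.P p.K).L + 1) ≤
      sideχ F (theta13LiveOfRecord F N).ν p (gOfRecord₁₃ F N (theta13LiveOfRecord F N) p) 0)
    (ha : 0 < epsOfRecord (theta13LiveOfRecord F N).ν (gOfRecord₁₃ F N (theta13LiveOfRecord F N) p) 0)
    (has : ((((F.P p.K).d + 4) * (F.P p.K).L : ℕ) : ℝ) ^ 2 / 4 * epsOfRecord (theta13LiveOfRecord F N).ν (gOfRecord₁₃ F N (theta13LiveOfRecord F N) p) 0 ≤
      deltaSU (Fin N) / 2)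
    {β : ℝ} (hβ : 0 < β) (hβ3 : (143 * (((((F.P p.K).d + 4 : ℕ) : ℝ)) ^ 2 / 4) ^ 2) * β ≤ 1 / 3)
    (hβ2 : 2 * β ≤ 2 * deltaSU (Fin N) / ((((F.P p.K).d + 4) * (F.P p.K).L : ℕ) : ℝ) ^ 2)
    (hβε : epsOfRecord (theta13LiveOfRecord F N).ν (gOfRecord₁₃ F N (theta13LiveOfRecord F N) p) 1 * (F.P p.K).eta 1 ^ 2 +
        4 * (2 * deltaOfRecord (theta13LiveOfRecord F N).ν (gOfRecord₁₃ F N (theta13LiveOfRecord F N) p) 0 (theta13LiveOfRecord F N).A₁) ≤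
      β * (F.P p.K).eta 1 ^ 2)
    (hg : ∃ g₀ : SU N,
      ((F.P p.K).L : ℝ) ^ 2 * epsOfRecord (theta13LiveOfRecord F N).ν (gOfRecord₁₃ F N (theta13LiveOfRecord F N) p) 0 +
          143 * (((((F.P p.K).d + 4) * (F.P p.K).L : ℕ) : ℝ) ^ 2 / 4 *
            epsOfRecord (theta13LiveOfRecord F N).ν (gOfRecord₁₃ F N (theta13LiveOfRecord F N) p) 0) ^ 2 < dist1 g₀ ∧
        2 * β < dist1 g₀) :
    ¬ (leavesP w p).smallCouplings := fun hsc =>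
  not_densitiesDescribed_leavesP_theta13LiveOfRecord_sepCo F N p w h hC hK hS ha has hβ hβ3 hβ2 hβε hg
    (h14 h7 h8 h9 h10 h11 hsf hfc (rOperation_leavesP_theta13LiveOfRecord_Co F N p w hup) hsc)

end AtRecord

section AtRecordSU2

variable (p : B12.RunParams) (w : WorldP) (h : (theta13LiveOfRecord F 2).Provisos₁₃SepCo F 2)

/-- ★★★ **AT THE GROUP OF RECORD `SU(2)`: `¬ densitiesDescribed` at every world bound to the v1.4 datum of `theta13LiveOfRecord F 2`** on every run with `0 < K`
meeting the cube-size condition and the two small-parameter guards (both thresholds `< 2`). [cite: Balaban1988Convergent, Thm 1 p.262, Theorem p.245, (3.25) p.270; Balaban1985Averaging, Prop. 1 (51) pp.25–26, Prop. 2 (52)–(54) p.26; Balaban1987RG1, (0.4) p.253] -/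
theorem not_densitiesDescribed_leavesP_theta13LiveOfRecord_sepCo_su2 (hC : w.C = (datumOfRecord₁₃SepCo F 2 (theta13LiveOfRecord F 2) h).C) (hK : 0 < p.K)
    (hS : 2 * ((((F.P p.K).d + 4) * (F.P p.K).L + 2) + (F.P p.K).L + 1) ≤
      sideχ F (theta13LiveOfRecord F 2).ν p (gOfRecord₁₃ F 2 (theta13LiveOfRecord F 2) p) 0)
    (ha : 0 < epsOfRecord (theta13LiveOfRecord F 2).ν (gOfRecord₁₃ F 2 (theta13LiveOfRecord F 2) p) 0)
    (has : ((((F.P p.K).d + 4) * (F.P p.K).L : ℕ) : ℝ) ^ 2 / 4 * epsOfRecord (theta13LiveOfRecord F 2).ν (gOfRecord₁₃ F 2 (theta13LiveOfRecord F 2) p) 0 ≤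
      deltaSU (Fin 2) / 2)
    (ha2 : ((F.P p.K).L : ℝ) ^ 2 * epsOfRecord (theta13LiveOfRecord F 2).ν (gOfRecord₁₃ F 2 (theta13LiveOfRecord F 2) p) 0 +
        143 * (((((F.P p.K).d + 4) * (F.P p.K).L : ℕ) : ℝ) ^ 2 / 4 *
          epsOfRecord (theta13LiveOfRecord F 2).ν (gOfRecord₁₃ F 2 (theta13LiveOfRecord F 2) p) 0) ^ 2 < 2)
    {β : ℝ} (hβ : 0 < β) (hβ3 : (143 * (((((F.P p.K).d + 4 : ℕ) : ℝ)) ^ 2 / 4) ^ 2) * β ≤ 1 / 3)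
    (hβ2 : 2 * β ≤ 2 * deltaSU (Fin 2) / ((((F.P p.K).d + 4) * (F.P p.K).L : ℕ) : ℝ) ^ 2)
    (hβε : epsOfRecord (theta13LiveOfRecord F 2).ν (gOfRecord₁₃ F 2 (theta13LiveOfRecord F 2) p) 1 * (F.P p.K).eta 1 ^ 2 +
        4 * (2 * deltaOfRecord (theta13LiveOfRecord F 2).ν (gOfRecord₁₃ F 2 (theta13LiveOfRecord F 2) p) 0 (theta13LiveOfRecord F 2).A₁) ≤
      β * (F.P p.K).eta 1 ^ 2) :
    ¬ (leavesP w p).densitiesDescribed := fun hD =>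
  not_sLaw₁₃Co_one_theta13LiveOfRecord_su2 p hK hS ha has ha2 hβ hβ3 hβ2 hβε
    ((densitiesDescribed_leavesP_iff_sLaw₁₃Co_all_sepCo F 2 (theta13LiveOfRecord F 2) p w h hC).1 hD 1 hK)

/-- ★★★ **AT `SU(2)`, with the C-binding of record over the Co view and true in-edges, a TRUE N11 conjunct at such a world FORCES `¬ smallCouplings`.**
[cite: Balaban1988Convergent, Thm 1 p.262, Theorem p.245, p.244, (3.25) p.270; Balaban1989LargeFieldII, Thm 1 p.355 (bookkeeping); Balaban1985Averaging, Prop. 1 (51) pp.25–26, Prop. 2 (52)–(54) p.26] -/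
theorem not_smallCouplings_of_b14_main_leavesP_theta13LiveOfRecord_sepCo_su2 (hC : w.C = (datumOfRecord₁₃SepCo F 2 (theta13LiveOfRecord F 2) h).C)
    (hup : w.up p = upOfRecord₅C F 2 ((theta13LiveOfRecord F 2).toStage5₁₃Co F 2) p)
    (h14 : Dag.B14_main (leavesP w p)) (h7 : (leavesP w p).b7) (h8 : (leavesP w p).b8) (h9 : (leavesP w p).b9) (h10 : (leavesP w p).b10)
    (h11 : (leavesP w p).b11) (hsf : (leavesP w p).smallCouplings → (leavesP w p).smallFieldInductive)
    (hfc : (leavesP w p).smallCouplings → (leavesP w p).flowControl) (hK : 0 < p.K)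
    (hS : 2 * ((((F.P p.K).d + 4) * (F.P p.K).L + 2) + (F.P p.K).L + 1) ≤
      sideχ F (theta13LiveOfRecord F 2).ν p (gOfRecord₁₃ F 2 (theta13LiveOfRecord F 2) p) 0)
    (ha : 0 < epsOfRecord (theta13LiveOfRecord F 2).ν (gOfRecord₁₃ F 2 (theta13LiveOfRecord F 2) p) 0)
    (has : ((((F.P p.K).d + 4) * (F.P p.K).L : ℕ) : ℝ) ^ 2 / 4 * epsOfRecord (theta13LiveOfRecord F 2).ν (gOfRecord₁₃ F 2 (theta13LiveOfRecord F 2) p) 0 ≤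
      deltaSU (Fin 2) / 2)
    (ha2 : ((F.P p.K).L : ℝ) ^ 2 * epsOfRecord (theta13LiveOfRecord F 2).ν (gOfRecord₁₃ F 2 (theta13LiveOfRecord F 2) p) 0 +
        143 * (((((F.P p.K).d + 4) * (F.P p.K).L : ℕ) : ℝ) ^ 2 / 4 *
          epsOfRecord (theta13LiveOfRecord F 2).ν (gOfRecord₁₃ F 2 (theta13LiveOfRecord F 2) p) 0) ^ 2 < 2)
    {β : ℝ} (hβ : 0 < β) (hβ3 : (143 * (((((F.P p.K).d + 4 : ℕ) : ℝ)) ^ 2 / 4) ^ 2) * β ≤ 1 / 3)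
    (hβ2 : 2 * β ≤ 2 * deltaSU (Fin 2) / ((((F.P p.K).d + 4) * (F.P p.K).L : ℕ) : ℝ) ^ 2)
    (hβε : epsOfRecord (theta13LiveOfRecord F 2).ν (gOfRecord₁₃ F 2 (theta13LiveOfRecord F 2) p) 1 * (F.P p.K).eta 1 ^ 2 +
        4 * (2 * deltaOfRecord (theta13LiveOfRecord F 2).ν (gOfRecord₁₃ F 2 (theta13LiveOfRecord F 2) p) 0 (theta13LiveOfRecord F 2).A₁) ≤
      β * (F.P p.K).eta 1 ^ 2) :
    ¬ (leavesP w p).smallCouplings := fun hsc =>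
  not_densitiesDescribed_leavesP_theta13LiveOfRecord_sepCo_su2 p w h hC hK hS ha has ha2 hβ hβ3 hβ2 hβε
    (h14 h7 h8 h9 h10 h11 hsf hfc (rOperation_leavesP_theta13LiveOfRecord_Co F 2 p w hup) hsc)

end AtRecordSU2

end Summit.QuantumFields.YangMills.Theorems.BalabanUVNodesN11NoDensitiesDescribedAtLiveRecordCo

end
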